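import Mathlib
import Summits.Ventures.PercRepro.TriangleCapFourRowThreeCap

/-!
# PercRepro — THE CAP ON THE CELL `(k, 5, 3)`: a `K₄⁻`-free graph with `5 (k − 5) − 3` edges on `k ≥ 13` vertices
with a vertex of degree `k − 5` is `5`-bipartite or at least `T = 2k − 22` below the closed form (p3, gen 46;
part 199g)

On the cell `(k, 5, 3)` (`r = a − 2`) the one-triangle family `T` of §10bt(e) exists: `K_{5,k−6}` with a vertex hung
on an edge is `2k − 22` below the closed form, less than `B2 = 4 (k − 11)` for `k > 11`. With `N = N(x)`,
`|N| = K = k − 5`, `M` the matching inside `N`, `R` the FOUR non-neighbours, `P = Σ_{u ∈ R} degIn N u`,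
`E = adjPairs R`:
* the degree sum is `2K + 2M + 2P + E = 2m = 10K − 6`; one end per matching edge gives `P + 4M ≤ 4K`;
  `E ≤ 8` is `K₄⁻`-freeness on the four vertices of `R`; an edge `u v` inside `R` gives `P_u + P_v ≤ K + 1` and
  `P_w + M ≤ K` for the other two, so `P + 2M ≤ 3K + 1`, against `2 (P + M) = 8K − 6 − E ≥ 8K − 14` as soon as
  `K ≥ 9` (`five_three_cap_count`); AT `K = 8` (`k = 13`) the count leaves `E = 8`, `M = 0`, `P = 25`, and then the
  other two non-neighbours `w, w'` see all of `N` (`P_w + P_{w'} ≥ 16`), are non-adjacent (two common neighbours),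
  and every vertex of `R` adjacent to one of them has at most one neighbour in `N` (`not_adj_both`); the four edges
  inside `R` avoid `w w'`, so `u` and `v` are each adjacent to `w` or `w'`, `P_u + P_v ≤ 2 < 9` — impossible
  (`five_three_noedge_eight`);
* `M = 0`: `D ⊆ K(N(x)ᶜ, N(x))`, `5`-bipartite;
* `M = 1`: `P = 4K − 4`, every `u ∈ R` has `d(u) = P_u ≤ K − 1`, so `Σ_R d² ≤ (K − 1) P = 4 (K − 1)²` (exact);
  every `y ∈ N` has `d(y) = 1 + f + g` with `f ≤ 1`, `g ≤ 4`, and `(1 + f + g)² ≤ 1 + 3f + 6g + 2fg`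
  (`cap_sq_bound_five`; the `g = 4` vertices are exact), `2 Σ_N f g ≤ |R| · adjPairs N = 8`; altogether
  `Σ d² ≤ K² + (25K − 10) + 4 (K − 1)² = 5K² + 17K − 6 = m k − 3 (k − 4) − (2k − 22)` EXACTLY
  (`five_three_cap_sq_arith`).
Axioms: standard.
-/

namespace PercRepro

namespace TriangleCap

namespace C047

open Finset

variable {V : Type*} [Fintype V] [DecidableEq V]

/-- The count at the cap of the cell `(k, 5, 3)`, `K ≥ 9`: `2K + 2M + 2P + E = 2m`, `m + 3 = 5K`, `P + 4M ≤ 4K`,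
`E ≤ 8`, and an edge inside `R` forces `P + 2M ≤ 3K + 1` ⇒ `E = 0` and `M ≤ 1`. -/
theorem five_three_cap_count (K M P E m : ℕ) (hdeg : K + (K + 2 * M + P) + (P + E) = 2 * m) (hm : m + 3 = 5 * K)
    (h2 : P + 4 * M ≤ 4 * K) (hE : E ≤ 8) (hK : 9 ≤ K) (hnoedge : 1 ≤ E → P + 2 * M ≤ 3 * K + 1) :
    E = 0 ∧ M ≤ 1 := by
  by_cases hE1 : 1 ≤ E
  · have := hnoedge hE1
    omega
  · omega

/-- The count at the cap of `(13, 5, 3)`: an edge inside `R` forces `E = 8`, `M = 0`, `P = 25`. -/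
theorem five_three_cap_count_eight (M P E m : ℕ) (hdeg : 8 + (8 + 2 * M + P) + (P + E) = 2 * m) (hm : m + 3 = 5 * 8)
    (hE : E ≤ 8) (hE1 : 1 ≤ E) (hnoedge : P + 2 * M ≤ 3 * 8 + 1) :
    E = 8 ∧ M = 0 ∧ P = 25 := by
  omega

/-- `(1 + f + g)² ≤ 1 + 3f + 6g + 2fg` for `f ≤ 1`, `g ≤ 4`. -/
theorem cap_sq_bound_five (f g : ℕ) (hf : f ≤ 1) (hg : g ≤ 4) :
    (1 + f + g) * (1 + f + g) ≤ 1 + 3 * f + 6 * g + 2 * (f * g) := by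
  interval_cases f <;> interval_cases g <;> norm_num

/-- **THE ARITHMETIC OF THE CASE `M = 1`:** `K ≥ 8`, `m + 3 = 5K`, `P + 4 = 4K`, `S_N ≤ K + 14 + 6P`,
`S_R ≤ (K − 1) P` ⇒ `K² + S_N + S_R + 3 (k − 4) + (2k − 22) ≤ m k` with `k = K + 5`. -/
theorem five_three_cap_sq_arith (K P SN SR m : ℕ) (hK : 8 ≤ K) (hm : m + 3 = 5 * K) (hP : P + 4 = 4 * K)
    (hSN : SN ≤ K + 14 + 6 * P) (hSR : SR ≤ (K - 1) * P) :
    K * K + SN + SR + 3 * (K + 5 - 4) + (2 * (K + 5) - 22) ≤ m * (K + 5) := by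
  obtain ⟨t, rfl⟩ : ∃ t, K = t + 8 := ⟨K - 8, by omega⟩
  have hP' : P = 4 * t + 28 := by omega
  have hm' : m = 5 * t + 37 := by omega
  subst hP' hm'
  have e1 : t + 8 + 5 - 4 = t + 9 := by omega
  have e2 : 2 * (t + 8 + 5) - 22 = 2 * t + 4 := by omega
  have e3 : t + 8 - 1 = t + 7 := by omega
  rw [e1, e2]
  rw [e3] at hSR
  nlinarith [hSN, hSR]

/-- **AN EDGE INSIDE `R` FORCES `P + 2M ≤ 3K + 1`** (`|R| = 4`): `P_u + P_v ≤ K + 1` on the edge and `P_w + M ≤ K`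
for each of the other two. -/
theorem five_three_noedge (D : SimpleGraph V) [DecidableRel D.Adj] (hK : K4mFree D) (N R : Finset V)
    (hRcard : R.card = 4) (K M : ℕ) (hKdef : N.card = K) (hPle : ∀ u ∈ R, degIn D N u + M ≤ K)
    (hE : 1 ≤ adjPairs D R) : ∑ u ∈ R, degIn D N u + 2 * M ≤ 3 * K + 1 := by
  obtain ⟨u, hu, hu1⟩ : ∃ u ∈ R, 1 ≤ degIn D R u := by
    by_contra hcon
    push Not at hcon
    have h0 : ∑ u ∈ R, degIn D R u = 0 := sum_eq_zero (fun u hu => by have := hcon u hu; omega)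
    rw [← adjPairs_eq_sum_degIn] at h0
    omega
  obtain ⟨v, hv, huv⟩ : ∃ v ∈ R, D.Adj u v := by
    unfold degIn at hu1
    obtain ⟨v, hv⟩ := card_pos.mp hu1
    rw [mem_filter] at hv
    exact ⟨v, hv.1, hv.2⟩
  have hne : u ≠ v := D.ne_of_adj huv
  have hPuv : degIn D N u + degIn D N v ≤ K + 1 := by
    have := degIn_add_degIn_le_of_adj_pair D hK N huv
    rw [hKdef] at this
    exact this
  have hvR' : v ∈ R.erase u := mem_erase.mpr ⟨hne.symm, hv⟩
  have hsum1 := add_sum_erase R (fun w => degIn D N w) hu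
  have hsum2 := add_sum_erase (R.erase u) (fun w => degIn D N w) hvR'
  have hcard2 : ((R.erase u).erase v).card = 2 := by
    rw [card_erase_of_mem hvR', card_erase_of_mem hu]
    omega
  have hrest : ∑ w ∈ (R.erase u).erase v, degIn D N w + 2 * M ≤ 2 * K := by
    have hs : ∑ w ∈ (R.erase u).erase v, (degIn D N w + M) ≤ ∑ _w ∈ (R.erase u).erase v, K :=
      sum_le_sum (fun w hw => hPle w (mem_of_mem_erase (mem_of_mem_erase hw)))
    rw [sum_add_distrib, sum_const, sum_const, smul_eq_mul, smul_eq_mul, hcard2] at hs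
    omega
  omega

/-- **THE CAP OF `(13, 5, 3)` HAS NO EDGE INSIDE `R`:** with `|N| = 8`, no edge inside `N`, `Σ_R degIn N = 25` and
`adjPairs R = 8`, a contradiction: the two non-neighbours off the edge see all of `N`, are non-adjacent, and make
their `R`-neighbours see at most one vertex of `N`. -/
theorem five_three_noedge_eight (D : SimpleGraph V) [DecidableRel D.Adj] (hK : K4mFree D) (N R : Finset V)
    (hRcard : R.card = 4)
    (hKdef : N.card = 8) (hPle : ∀ u ∈ R, degIn D N u ≤ 8) (hP : ∑ u ∈ R, degIn D N u = 25)
    (hE : adjPairs D R = 8) : False := by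
  -- an edge `u v` inside `R`
  obtain ⟨u, hu, hu1⟩ : ∃ u ∈ R, 1 ≤ degIn D R u := by
    by_contra hcon
    push Not at hcon
    have h0 : ∑ u ∈ R, degIn D R u = 0 := sum_eq_zero (fun u hu => by have := hcon u hu; omega)
    rw [← adjPairs_eq_sum_degIn] at h0
    omega
  obtain ⟨v, hv, huv⟩ : ∃ v ∈ R, D.Adj u v := by
    unfold degIn at hu1
    obtain ⟨v, hv⟩ := card_pos.mp hu1
    rw [mem_filter] at hv
    exact ⟨v, hv.1, hv.2⟩
  have hne : u ≠ v := D.ne_of_adj huv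
  have hPuv : degIn D N u + degIn D N v ≤ 9 := by
    have := degIn_add_degIn_le_of_adj_pair D hK N huv
    rw [hKdef] at this
    exact this
  -- the other two vertices `w, w'`
  have hvR' : v ∈ R.erase u := mem_erase.mpr ⟨hne.symm, hv⟩
  have hcard2 : ((R.erase u).erase v).card = 2 := by
    rw [card_erase_of_mem hvR', card_erase_of_mem hu]
    omega
  obtain ⟨w, w', hww', hw2⟩ := card_eq_two.mp hcard2
  have hwmem : w ∈ (R.erase u).erase v := by rw [hw2]; exact mem_insert_self w {w'}
  have hw'mem : w' ∈ (R.erase u).erase v := by rw [hw2]; exact mem_insert_of_mem (mem_singleton_self w')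
  have hwv : w ≠ v := (mem_erase.mp hwmem).1
  have hwu : w ≠ u := (mem_erase.mp (mem_of_mem_erase hwmem)).1
  have hwR : w ∈ R := mem_of_mem_erase (mem_of_mem_erase hwmem)
  have hw'v : w' ≠ v := (mem_erase.mp hw'mem).1
  have hw'u : w' ≠ u := (mem_erase.mp (mem_of_mem_erase hw'mem)).1
  have hw'R : w' ∈ R := mem_of_mem_erase (mem_of_mem_erase hw'mem)
  have hR4 : R = insert u (insert v (insert w {w'})) := by
    rw [← hw2, insert_erase hvR', insert_erase hu]
  have hsum4 : ∀ f : V → ℕ, ∑ t ∈ R, f t = f u + f v + f w + f w' := by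
    intro f
    rw [hR4, sum_insert, sum_insert, sum_insert, sum_singleton, add_assoc, add_assoc]
    · rw [mem_singleton]; exact hww'
    · rw [mem_insert, mem_singleton]; push Not; exact ⟨hwv.symm, hw'v.symm⟩
    · rw [mem_insert, mem_insert, mem_singleton]; push Not; exact ⟨hne, hwu.symm, hw'u.symm⟩
  have hmemR4 : ∀ t, t ∈ R ↔ t = u ∨ t = v ∨ t = w ∨ t = w' := by
    intro t
    rw [hR4, mem_insert, mem_insert, mem_insert, mem_singleton]
  -- `P_w = P_{w'} = 8`: they see all of `N`
  have hPw8 : degIn D N w = 8 ∧ degIn D N w' = 8 := by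
    rw [hsum4] at hP
    have := hPle w hwR
    have := hPle w' hw'R
    omega
  have hall : ∀ t, degIn D N t = 8 → ∀ y ∈ N, D.Adj t y := by
    intro t ht y hy
    unfold degIn at ht
    have hsub : N.filter (fun s => D.Adj t s) ⊆ N := filter_subset _ _
    have heq : N.filter (fun s => D.Adj t s) = N := eq_of_subset_of_card_le hsub (by rw [ht, hKdef])
    have : y ∈ N.filter (fun s => D.Adj t s) := by rw [heq]; exact hy
    exact (mem_filter.mp this).2
  have hwall := hall w hPw8.1
  have hw'all := hall w' hPw8.2
  -- two vertices of `N`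
  obtain ⟨y₁, hy₁, y₂, hy₂, hy12⟩ : ∃ y₁ ∈ N, ∃ y₂ ∈ N, y₁ ≠ y₂ := by
    have h1 : 1 < N.card := by omega
    obtain ⟨y₁, hy₁, y₂, hy₂, h⟩ := one_lt_card.mp h1
    exact ⟨y₁, hy₁, y₂, hy₂, h⟩
  -- `w ≁ w'`
  have hnww' : ¬ D.Adj w w' := fun h =>
    not_adj_both D hK h (hwall y₁ hy₁) (hw'all y₁ hy₁) hy12 (hwall y₂ hy₂) (hw'all y₂ hy₂)
  -- a vertex of `R` adjacent to `w` (or `w'`) sees at most one vertex of `N`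
  have hone : ∀ t z, (∀ y ∈ N, D.Adj z y) → D.Adj t z → degIn D N t ≤ 1 := by
    intro t z hz htz
    unfold degIn
    apply card_le_one.mpr
    intro a ha b hb
    rw [mem_filter] at ha hb
    by_contra hab
    exact not_adj_both D hK htz ha.2 (hz a ha.1) hab hb.2 (hz b hb.1)
  -- `u` is adjacent to `w` or `w'`, and so is `v`
  have hdegR : ∀ t ∈ R, degIn D R t ≤ 3 := fun t ht => by
    have := degIn_le_card_sub_one D ht
    rw [hRcard] at this
    exact this
  have hsub1 : ∀ t s₀, (∀ s ∈ R, D.Adj t s → s = s₀) → degIn D R t ≤ 1 := by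
    intro t s₀ ht
    unfold degIn
    have : R.filter (fun s => D.Adj t s) ⊆ {s₀} := by
      intro s hs
      rw [mem_filter] at hs
      rw [mem_singleton]
      exact ht s hs.1 hs.2
    have := card_le_card this
    rw [card_singleton] at this
    exact this
  have hEsum : degIn D R u + degIn D R v + degIn D R w + degIn D R w' = 8 := by
    rw [← hsum4, ← adjPairs_eq_sum_degIn, hE]
  have huw : D.Adj u w ∨ D.Adj u w' := by
    by_contra hcon
    push Not at hcon
    have h1 : degIn D R u ≤ 1 := hsub1 u v (fun s hs hus => by
      rcases (hmemR4 s).mp hs with rfl | rfl | rfl | rfl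
      · exact absurd hus (D.irrefl)
      · rfl
      · exact absurd hus hcon.1
      · exact absurd hus hcon.2)
    have h3 : degIn D R w ≤ 1 := hsub1 w v (fun s hs hws => by
      rcases (hmemR4 s).mp hs with rfl | rfl | rfl | rfl
      · exact absurd (D.adj_symm hws) hcon.1
      · rfl
      · exact absurd hws (D.irrefl)
      · exact absurd hws hnww')
    have h4 : degIn D R w' ≤ 1 := hsub1 w' v (fun s hs hws => by
      rcases (hmemR4 s).mp hs with rfl | rfl | rfl | rfl
      · exact absurd (D.adj_symm hws) hcon.2
      · rfl
      · exact absurd (D.adj_symm hws) hnww'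
      · exact absurd hws (D.irrefl))
    have h2 := hdegR v hv
    omega
  have hvw : D.Adj v w ∨ D.Adj v w' := by
    by_contra hcon
    push Not at hcon
    have h2 : degIn D R v ≤ 1 := hsub1 v u (fun s hs hvs => by
      rcases (hmemR4 s).mp hs with rfl | rfl | rfl | rfl
      · rfl
      · exact absurd hvs (D.irrefl)
      · exact absurd hvs hcon.1
      · exact absurd hvs hcon.2)
    have h3 : degIn D R w ≤ 1 := hsub1 w u (fun s hs hws => by
      rcases (hmemR4 s).mp hs with rfl | rfl | rfl | rfl
      · rfl
      · exact absurd (D.adj_symm hws) hcon.1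
      · exact absurd hws (D.irrefl)
      · exact absurd hws hnww')
    have h4 : degIn D R w' ≤ 1 := hsub1 w' u (fun s hs hws => by
      rcases (hmemR4 s).mp hs with rfl | rfl | rfl | rfl
      · rfl
      · exact absurd (D.adj_symm hws) hcon.2
      · exact absurd (D.adj_symm hws) hnww'
      · exact absurd hws (D.irrefl))
    have h1 := hdegR u hu
    omega
  have hPu1 : degIn D N u ≤ 1 := by
    rcases huw with h | h
    · exact hone u w hwall h
    · exact hone u w' hw'all h
  have hPv1 : degIn D N v ≤ 1 := by
    rcases hvw with h | h
    · exact hone v w hwall h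
    · exact hone v w' hw'all h
  rw [hsum4] at hP
  omega

end C047

end TriangleCap

end PercRepro
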